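import Summits.HodgeConjecture.HodgeConjecture.Theorems.Ring2WeilCoverageFrameFreePlacementC
import HarnessLib

/-!
# Weil-type family coverage — frame-free placement D: the binary ICOSAHEDRAL CM fourfolds (`ℍ_ℚ ⊗ ℚ(√5)`-multiplication)

research route conditional on HC_CM; not a corollary; Q11.4-sentence-2 already refuted in dim ≥ 3.

Ring 2, WEIL-TYPE FAMILY-COVERAGE CENSUS (`HOME/WEIL-FAMILY-COVERAGE.md` `## b04`, block b04.11 (A), owner ring2-b04),
fourth part of `Ring2WeilCoverageFrameFreePlacement{,B,C}`: the last finite quaternion group of the census window, the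
binary icosahedral group `2I` (order `120`), `2I ⊂ (ℍ_ℚ ⊗ ℚ(√5))ˣ` (the icosians).  Its two faithful `2`-dimensional
characters (values in `ℚ(√5)`) are one Galois orbit of quaternionic type and cut out of `ℚ[2I]` the simple component
`D = ℍ_ℚ ⊗ ℚ(√5)` (centre `F = ℚ(√5)`, `e = 2`, unramified at every finite place: `R(D) = ∅`), so EVERY imaginary
quadratic `K = ℚ(√-d)` embeds in `D` and, by the frame-free placement theorem of part A (`e` even, `R(D) = ∅`), the
component of `(P, K, Θ|P)` for the `D`-isotypic piece `P` of a `2I`-curve is the class of ONE rational number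
`C = N_{F/ℚ}(Nrd cᵗ)`, the same for all fifteen census fields.

The census tier `q = 0`, `N = 3`, `g(C̃) ≤ 25` (kit j182990 / j183001 / j183009 / j183022 / j183028 / j183038, engine
`icosa.py` of gen 46): every admissible triangle datum has `dim P = 4`, `k = 1` (`H¹(P, ℚ) ≅ D` as a left `D`-module)
— hence `P` is a CM abelian FOURFOLD (its Hodge group sits in the `ℝ`-anisotropic group `SL₁(Dᵒᵖ)`; equivalently
Shimura's exclusion of type III with `m = 1`), a CM POINT WITH A CURVE of `K`-signature `(2,2)` — and
`C ≡ 5^{#(branch points of order 5)} (mod ℚ^{×2})`: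

* `C ≡ 5`: `(0; 3,4,5)` = Klein's curve `X₁₄ : y² = t₅(x) = x³⁰ + 522x²⁵ − 10005x²⁰ − 10005x¹⁰ − 522x⁵ + 1` (genus 14,
  whole Jacobian CM in print [Müller–Pink 2021/22, Prop. 4.4]), exact `C = 1/4500 = 5·(1/150)²`; `(0; 3,5,6)`
  (genus 19, `C = 1/1125`, twin `1/720`), `(0; 3,5,10′)` (genus 23, `C = 1/18000`), `(0; 4,5′,6)` = `X₁₇ : y² = r₅t₅`
  (genus 24, `C = 1/40500`): NON-split exactly at the eleven census fields with `5 ∉ Nm(ℚ(√-d)ˣ)`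
  (`d = 2, 3, 7, 13, 23, 43, 67, 163` — rows `W4.d.5` — and `d = 6, 10, 15` — rows `W4.6.2`, `W4.10.2`, `W4.15.2`),
  SPLIT at `d = 1, 5, 11, 19` (§2–§3);
* `C ≡ 1`: `(0; 3,3,10)` (genus 15, `C = 1/10000`), `(0; 3,5,5′)` (genus 17, `C = 1/225`), `(0; 3,4,10) = X₁₆ : y² =
  s₅t₅` (genus 20, `C = 1/22500`), `(0; 4,5,5′)` (genus 22, double cover of Bring's curve, `C = 1/8100`): SPLIT for every `K` (§4).

§1 adds the four norm facts the `5`-column still lacked (`d = 5, 6, 10, 15`).  No `def`, no named fact, no `sorry`;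
nothing here is a statement about Hodge classes; `HC_CM` is used nowhere.

References: [cite: vanGeemen1994HodgeAV, 5.4 and (5.4.1)]; [cite: Serre1973, Ch. III §1];
[cite: MullerPink2021, Table 1, Prop. 4.4, Prop. 5.1].
-/

noncomputable section

set_option linter.dupNamespace false

open Literature.AlgebraicGeometry.Motives
open Literature.AlgebraicGeometry.VanGeemen1994
open Summit.HodgeConjecture.HodgeConjecture.Ring2.Hypotheses

namespace Summit.HodgeConjecture.HodgeConjecture.Ring2.WeilCoverage

/-! ### §1 Norm facts: the `5`-column at `ℚ(√-5)`, `ℚ(√-6)`, `ℚ(√-10)`, `ℚ(√-15)` -/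

namespace SqrtNeg5

/-- `5 ∈ Nm(ℚ(√-5)ˣ)`: `5 = 0² + 5·1²`. research route conditional on HC_CM; not a corollary; Q11.4-sentence-2 already refuted in dim ≥ 3. [cite: vanGeemen1994HodgeAV, 4.14] -/
theorem mem_5 : Units.mk0 (5 : ℚ) (by norm_num) ∈ normUnitsSubgroup ℚ (weilField 5) :=
  mem_normUnitsSubgroup_of_sq_add_mul_sq _ 0 1 (by norm_num)

end SqrtNeg5

namespace SqrtNeg6

/-- `5 ∉ Nm(ℚ(√-6)ˣ)`: descent at the ramified prime `3` (`3 ∥ 6`, `5 ≡ 2` is a non-square mod `3`).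
research route conditional on HC_CM; not a corollary; Q11.4-sentence-2 already refuted in dim ≥ 3. [cite: Serre1973, Ch. III §1] -/
theorem not_mem_5 : Units.mk0 (5 : ℚ) (by norm_num) ∉ normUnitsSubgroup ℚ (weilField 6) := by
  simpa using natCast_not_mem_normUnitsSubgroup_of_ramified (d := 6) (a := 5) (p := 3)
    (by norm_num) (by norm_num) (by norm_num) (by decide) (by norm_num)

end SqrtNeg6

namespace SqrtNeg15

/-- `5 ∉ Nm(ℚ(√-15)ˣ)`: descent at the ramified prime `3` (`3 ∥ 15`, `5 ≡ 2` is a non-square mod `3`).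
research route conditional on HC_CM; not a corollary; Q11.4-sentence-2 already refuted in dim ≥ 3. [cite: Serre1973, Ch. III §1] -/
theorem not_mem_5 : Units.mk0 (5 : ℚ) (by norm_num) ∉ normUnitsSubgroup ℚ (weilField 15) := by
  simpa using natCast_not_mem_normUnitsSubgroup_of_ramified (d := 15) (a := 5) (p := 3)
    (by norm_num) (by norm_num) (by norm_num) (by decide) (by norm_num)

end SqrtNeg15

namespace SqrtNeg10

/-- `5/2 ∈ Nm(ℚ(√-10)ˣ)`: `5/2 = 0² + 10·(1/2)²`. research route conditional on HC_CM; not a corollary; Q11.4-sentence-2 already refuted in dim ≥ 3. [cite: vanGeemen1994HodgeAV, 4.14] -/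
theorem mem_five_halves : Units.mk0 ((5 : ℚ) / 2) (by norm_num) ∈ normUnitsSubgroup ℚ (weilField 10) :=
  mem_normUnitsSubgroup_of_sq_add_mul_sq _ 0 (1 / 2) (by norm_num)

/-- `5 ∉ Nm(ℚ(√-10)ˣ)`: `5 = (5/2)·2` with `5/2` a norm and `2 ∉ Nm(ℚ(√-10)ˣ)` (`Ring2WeilNormDescent.SqrtNeg10.not_mem_2`)
— the classes `[5] = [2]` coincide modulo `Nm`, which is why the census row is `W4.10.2`.
research route conditional on HC_CM; not a corollary; Q11.4-sentence-2 already refuted in dim ≥ 3. [cite: Serre1973, Ch. III §1] -/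
theorem not_mem_5 : Units.mk0 (5 : ℚ) (by norm_num) ∉ normUnitsSubgroup ℚ (weilField 10) := by
  have e : Units.mk0 (5 : ℚ) (by norm_num) =
      Units.mk0 ((5 : ℚ) / 2) (by norm_num) * Units.mk0 (2 : ℚ) (by norm_num) :=
    Units.ext (by simp only [Units.val_mul, Units.val_mk0]; norm_num)
  rw [e]
  exact mul_not_mem_normUnitsSubgroup mem_five_halves Summit.HodgeConjecture.Ring2WeilNormDescent.SqrtNeg10.not_mem_2

end SqrtNeg10

/-! ### §2 The class of the `2I` CM fourfolds with `C ≡ 5`: one iff for every field -/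

/-- **Shell for the `5`-column at `n = 2`**: a discriminant `a = 5·s²` lies in the split class of `(2, ℚ(√-d), ·)` iff
`5 ∈ Nm(ℚ(√-d)ˣ)`. research route conditional on HC_CM; not a corollary; Q11.4-sentence-2 already refuted in dim ≥ 3. [cite: vanGeemen1994HodgeAV, (5.4.1)] -/
theorem mk_eq_split_two_iff_five_mem {d : ℕ} {a s : ℚ} (ha : a ≠ 0) (hs : s ≠ 0) (h : a = 5 * s ^ 2) :
    (QuotientGroup.mk (Units.mk0 a ha) : weilNormResidueGroup d) = splitDiscriminantClass 2 d ↔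
      Units.mk0 (5 : ℚ) (by norm_num) ∈ normUnitsSubgroup ℚ (weilField d) :=
  mk_eq_split_iff_of_eq_mul_norm_mul_sq (n := 2) (by decide) (C := 5) (ν := 1) ha (by norm_num) one_ne_zero hs
    (by rw [h]; ring) (one_mem_normUnitsSubgroup d)

/-- **Frame-free class of Klein's curve `X₁₄ : y² = t₅(x)` (the `2I`-cover `(0; 3,4,5)`, genus 14)**: the `ℍ_ℚ ⊗ ℚ(√5)`-
isotypic piece `P ⊂ J(X₁₄)` is a CM abelian fourfold (`k = 1`), of Weil type `(2,2)` for every `K = ℚ(√-d) ⊂ ℍ_ℚ ⊗ ℚ(√5)`,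
with exact invariant `C = 1/4500 = 5·(1/150)²`: its component is split iff `5 ∈ Nm(ℚ(√-d)ˣ)`.
research route conditional on HC_CM; not a corollary; Q11.4-sentence-2 already refuted in dim ≥ 3. [cite: vanGeemen1994HodgeAV, (5.4.1)] -/
theorem fourfold_icosahedral345_mk_C_eq_split_iff (d : ℕ) :
    (QuotientGroup.mk (Units.mk0 ((1 : ℚ) / 4500) (by norm_num)) : weilNormResidueGroup d) =
      splitDiscriminantClass 2 d ↔ Units.mk0 (5 : ℚ) (by norm_num) ∈ normUnitsSubgroup ℚ (weilField d) :=
  mk_eq_split_two_iff_five_mem (s := (1 : ℚ) / 150) (by norm_num) (by norm_num) (by norm_num)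

/-- The `2I`-cover `(0; 3,5,6)` (genus 19, `k = 1`, CM fourfold), `C = 1/1125 = 5·(1/75)²`: same class as `X₁₄`'s piece.
research route conditional on HC_CM; not a corollary; Q11.4-sentence-2 already refuted in dim ≥ 3. [cite: vanGeemen1994HodgeAV, (5.4.1)] -/
theorem fourfold_icosahedral356_mk_C_eq_split_iff (d : ℕ) :
    (QuotientGroup.mk (Units.mk0 ((1 : ℚ) / 1125) (by norm_num)) : weilNormResidueGroup d) =
      splitDiscriminantClass 2 d ↔ Units.mk0 (5 : ℚ) (by norm_num) ∈ normUnitsSubgroup ℚ (weilField d) :=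
  mk_eq_split_two_iff_five_mem (s := (1 : ℚ) / 75) (by norm_num) (by norm_num) (by norm_num)

/-- Its outer twin `(0; 3,5′,6)` (the same curve, `2I`-action twisted by the outer automorphism), `C = 1/720 = 5·(1/60)²`:
the exact invariant changes with the `D`-generator, its square class does not.
research route conditional on HC_CM; not a corollary; Q11.4-sentence-2 already refuted in dim ≥ 3. [cite: vanGeemen1994HodgeAV, (5.4.1)] -/
theorem fourfold_icosahedral356twin_mk_C_eq_split_iff (d : ℕ) :
    (QuotientGroup.mk (Units.mk0 ((1 : ℚ) / 720) (by norm_num)) : weilNormResidueGroup d) =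
      splitDiscriminantClass 2 d ↔ Units.mk0 (5 : ℚ) (by norm_num) ∈ normUnitsSubgroup ℚ (weilField d) :=
  mk_eq_split_two_iff_five_mem (s := (1 : ℚ) / 60) (by norm_num) (by norm_num) (by norm_num)

/-- The `2I`-cover `(0; 3,5,10′)` (genus 23, `k = 1`, CM fourfold), `C = 1/18000 = 5·(1/300)²`.
research route conditional on HC_CM; not a corollary; Q11.4-sentence-2 already refuted in dim ≥ 3. [cite: vanGeemen1994HodgeAV, (5.4.1)] -/
theorem fourfold_icosahedral3510_mk_C_eq_split_iff (d : ℕ) :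
    (QuotientGroup.mk (Units.mk0 ((1 : ℚ) / 18000) (by norm_num)) : weilNormResidueGroup d) =
      splitDiscriminantClass 2 d ↔ Units.mk0 (5 : ℚ) (by norm_num) ∈ normUnitsSubgroup ℚ (weilField d) :=
  mk_eq_split_two_iff_five_mem (s := (1 : ℚ) / 300) (by norm_num) (by norm_num) (by norm_num)

/-- The `2I`-cover `(0; 4,5′,6)` = Müller–Pink's `X₁₇ : y² = r₅(x)t₅(x)` (genus 24; its `ℍ_ℚ ⊗ ℚ(√5)`-piece is a CM
fourfold although `J(X₁₇)` as a whole is not CM), `C = 1/40500 = 5·(1/450)²`.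
research route conditional on HC_CM; not a corollary; Q11.4-sentence-2 already refuted in dim ≥ 3. [cite: vanGeemen1994HodgeAV, (5.4.1)] -/
theorem fourfold_icosahedral456_mk_C_eq_split_iff (d : ℕ) :
    (QuotientGroup.mk (Units.mk0 ((1 : ℚ) / 40500) (by norm_num)) : weilNormResidueGroup d) =
      splitDiscriminantClass 2 d ↔ Units.mk0 (5 : ℚ) (by norm_num) ∈ normUnitsSubgroup ℚ (weilField d) :=
  mk_eq_split_two_iff_five_mem (s := (1 : ℚ) / 450) (by norm_num) (by norm_num) (by norm_num)

/-! ### §3 The fifteen census fields for `X₁₄`'s CM fourfold (rows of TABLE F of b04.11) -/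

/-- **`(2, ℚ(√-3), [5])` = row `W4.3.5` carries the CM fourfold of Klein's curve `X₁₄`** (`5` inert in `ℚ(√-3)`).
research route conditional on HC_CM; not a corollary; Q11.4-sentence-2 already refuted in dim ≥ 3. [cite: vanGeemen1994HodgeAV, (5.4.1)] -/
theorem fourfold_sqrtNeg3_icosahedral345_ne_split :
    (QuotientGroup.mk (Units.mk0 ((1 : ℚ) / 4500) (by norm_num)) : weilNormResidueGroup 3) ≠
      splitDiscriminantClass 2 3 := fun h =>
  Summit.HodgeConjecture.Ring2WeilNormDescent.five_not_mem_norm_three ((fourfold_icosahedral345_mk_C_eq_split_iff 3).1 h)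

/-- Row `W4.2.5` (`5` inert in `ℚ(√-2)`). research route conditional on HC_CM; not a corollary; Q11.4-sentence-2 already refuted in dim ≥ 3. [cite: vanGeemen1994HodgeAV, (5.4.1)] -/
theorem fourfold_sqrtNeg2_icosahedral345_ne_split :
    (QuotientGroup.mk (Units.mk0 ((1 : ℚ) / 4500) (by norm_num)) : weilNormResidueGroup 2) ≠
      splitDiscriminantClass 2 2 := fun h =>
  Summit.HodgeConjecture.Ring2WeilNormDescent.five_not_mem_norm_two ((fourfold_icosahedral345_mk_C_eq_split_iff 2).1 h)

/-- Row `W4.7.5` (`5` inert in `ℚ(√-7)`). research route conditional on HC_CM; not a corollary; Q11.4-sentence-2 already refuted in dim ≥ 3. [cite: vanGeemen1994HodgeAV, (5.4.1)] -/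
theorem fourfold_sqrtNeg7_icosahedral345_ne_split :
    (QuotientGroup.mk (Units.mk0 ((1 : ℚ) / 4500) (by norm_num)) : weilNormResidueGroup 7) ≠
      splitDiscriminantClass 2 7 := fun h =>
  Summit.HodgeConjecture.Ring2WeilNormDescent.five_not_mem_norm_seven ((fourfold_icosahedral345_mk_C_eq_split_iff 7).1 h)

/-- Row `W4.13.5`. research route conditional on HC_CM; not a corollary; Q11.4-sentence-2 already refuted in dim ≥ 3. [cite: vanGeemen1994HodgeAV, (5.4.1)] -/
theorem fourfold_sqrtNeg13_icosahedral345_ne_split :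
    (QuotientGroup.mk (Units.mk0 ((1 : ℚ) / 4500) (by norm_num)) : weilNormResidueGroup 13) ≠
      splitDiscriminantClass 2 13 := fun h =>
  SqrtNeg13.not_mem_5 ((fourfold_icosahedral345_mk_C_eq_split_iff 13).1 h)

/-- Row `W4.23.5`. research route conditional on HC_CM; not a corollary; Q11.4-sentence-2 already refuted in dim ≥ 3. [cite: vanGeemen1994HodgeAV, (5.4.1)] -/
theorem fourfold_sqrtNeg23_icosahedral345_ne_split :
    (QuotientGroup.mk (Units.mk0 ((1 : ℚ) / 4500) (by norm_num)) : weilNormResidueGroup 23) ≠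
      splitDiscriminantClass 2 23 := fun h =>
  SqrtNeg23.not_mem_5 ((fourfold_icosahedral345_mk_C_eq_split_iff 23).1 h)

/-- Row `W4.43.5`. research route conditional on HC_CM; not a corollary; Q11.4-sentence-2 already refuted in dim ≥ 3. [cite: vanGeemen1994HodgeAV, (5.4.1)] -/
theorem fourfold_sqrtNeg43_icosahedral345_ne_split :
    (QuotientGroup.mk (Units.mk0 ((1 : ℚ) / 4500) (by norm_num)) : weilNormResidueGroup 43) ≠
      splitDiscriminantClass 2 43 := fun h =>
  SqrtNeg43.not_mem_5 ((fourfold_icosahedral345_mk_C_eq_split_iff 43).1 h)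

/-- Row `W4.67.5`. research route conditional on HC_CM; not a corollary; Q11.4-sentence-2 already refuted in dim ≥ 3. [cite: vanGeemen1994HodgeAV, (5.4.1)] -/
theorem fourfold_sqrtNeg67_icosahedral345_ne_split :
    (QuotientGroup.mk (Units.mk0 ((1 : ℚ) / 4500) (by norm_num)) : weilNormResidueGroup 67) ≠
      splitDiscriminantClass 2 67 := fun h =>
  SqrtNeg67.not_mem_5 ((fourfold_icosahedral345_mk_C_eq_split_iff 67).1 h)

/-- Row `W4.163.5`. research route conditional on HC_CM; not a corollary; Q11.4-sentence-2 already refuted in dim ≥ 3. [cite: vanGeemen1994HodgeAV, (5.4.1)] -/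
theorem fourfold_sqrtNeg163_icosahedral345_ne_split :
    (QuotientGroup.mk (Units.mk0 ((1 : ℚ) / 4500) (by norm_num)) : weilNormResidueGroup 163) ≠
      splitDiscriminantClass 2 163 := fun h =>
  SqrtNeg163.not_mem_5 ((fourfold_icosahedral345_mk_C_eq_split_iff 163).1 h)

/-- Row `W4.6.2` (`[5] = [2]` modulo `Nm(ℚ(√-6)ˣ)`). research route conditional on HC_CM; not a corollary; Q11.4-sentence-2 already refuted in dim ≥ 3. [cite: vanGeemen1994HodgeAV, (5.4.1)] -/
theorem fourfold_sqrtNeg6_icosahedral345_ne_split :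
    (QuotientGroup.mk (Units.mk0 ((1 : ℚ) / 4500) (by norm_num)) : weilNormResidueGroup 6) ≠
      splitDiscriminantClass 2 6 := fun h =>
  SqrtNeg6.not_mem_5 ((fourfold_icosahedral345_mk_C_eq_split_iff 6).1 h)

/-- Row `W4.10.2` (`[5] = [2]` modulo `Nm(ℚ(√-10)ˣ)`). research route conditional on HC_CM; not a corollary; Q11.4-sentence-2 already refuted in dim ≥ 3. [cite: vanGeemen1994HodgeAV, (5.4.1)] -/
theorem fourfold_sqrtNeg10_icosahedral345_ne_split :
    (QuotientGroup.mk (Units.mk0 ((1 : ℚ) / 4500) (by norm_num)) : weilNormResidueGroup 10) ≠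
      splitDiscriminantClass 2 10 := fun h =>
  SqrtNeg10.not_mem_5 ((fourfold_icosahedral345_mk_C_eq_split_iff 10).1 h)

/-- Row `W4.15.2` (`[5] = [3] = [2]` modulo `Nm(ℚ(√-15)ˣ)`). research route conditional on HC_CM; not a corollary; Q11.4-sentence-2 already refuted in dim ≥ 3. [cite: vanGeemen1994HodgeAV, (5.4.1)] -/
theorem fourfold_sqrtNeg15_icosahedral345_ne_split :
    (QuotientGroup.mk (Units.mk0 ((1 : ℚ) / 4500) (by norm_num)) : weilNormResidueGroup 15) ≠
      splitDiscriminantClass 2 15 := fun h =>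
  SqrtNeg15.not_mem_5 ((fourfold_icosahedral345_mk_C_eq_split_iff 15).1 h)

/-- SPLIT at `ℚ(i)` (`5 = 1² + 2²`): row `W4.1.1`. research route conditional on HC_CM; not a corollary; Q11.4-sentence-2 already refuted in dim ≥ 3. [cite: vanGeemen1994HodgeAV, (5.4.1)] -/
theorem fourfold_sqrtNeg1_icosahedral345_eq_split :
    (QuotientGroup.mk (Units.mk0 ((1 : ℚ) / 4500) (by norm_num)) : weilNormResidueGroup 1) =
      splitDiscriminantClass 2 1 :=
  (fourfold_icosahedral345_mk_C_eq_split_iff 1).2 SqrtNeg1.mem_5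

/-- SPLIT at `ℚ(√-11)` (`5 = Nm((1+√-11)/2 + 1)`, i.e. `4·5 = 3² + 11·1²`): row `W4.11.1`. research route conditional on HC_CM; not a corollary; Q11.4-sentence-2 already refuted in dim ≥ 3. [cite: vanGeemen1994HodgeAV, (5.4.1)] -/
theorem fourfold_sqrtNeg11_icosahedral345_eq_split :
    (QuotientGroup.mk (Units.mk0 ((1 : ℚ) / 4500) (by norm_num)) : weilNormResidueGroup 11) =
      splitDiscriminantClass 2 11 :=
  (fourfold_icosahedral345_mk_C_eq_split_iff 11).2 SqrtNeg11.mem_5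

/-- SPLIT at `ℚ(√-19)` (`4·5 = 1² + 19·1²`): row `W4.19.1`. research route conditional on HC_CM; not a corollary; Q11.4-sentence-2 already refuted in dim ≥ 3. [cite: vanGeemen1994HodgeAV, (5.4.1)] -/
theorem fourfold_sqrtNeg19_icosahedral345_eq_split :
    (QuotientGroup.mk (Units.mk0 ((1 : ℚ) / 4500) (by norm_num)) : weilNormResidueGroup 19) =
      splitDiscriminantClass 2 19 :=
  (fourfold_icosahedral345_mk_C_eq_split_iff 19).2 SqrtNeg19.mem_5

/-- SPLIT at `ℚ(√-5)` (`5 = Nm(√-5)`): row `W4.5.1`. research route conditional on HC_CM; not a corollary; Q11.4-sentence-2 already refuted in dim ≥ 3. [cite: vanGeemen1994HodgeAV, (5.4.1)] -/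
theorem fourfold_sqrtNeg5_icosahedral345_eq_split :
    (QuotientGroup.mk (Units.mk0 ((1 : ℚ) / 4500) (by norm_num)) : weilNormResidueGroup 5) =
      splitDiscriminantClass 2 5 :=
  (fourfold_icosahedral345_mk_C_eq_split_iff 5).2 SqrtNeg5.mem_5

/-! ### §4 The `2I` CM fourfolds with `C ≡ 1`: split for every `K` -/

/-- **Shell**: a discriminant that is a rational SQUARE lies in the split class of `(2, ℚ(√-d), ·)` for every `d`.
research route conditional on HC_CM; not a corollary; Q11.4-sentence-2 already refuted in dim ≥ 3. [cite: vanGeemen1994HodgeAV, (5.4.1)] -/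
theorem mk_eq_split_two_of_eq_sq (d : ℕ) {a s : ℚ} (ha : a ≠ 0) (hs : s ≠ 0) (h : a = s ^ 2) :
    (QuotientGroup.mk (Units.mk0 a ha) : weilNormResidueGroup d) = splitDiscriminantClass 2 d :=
  (mk_eq_split_iff_of_eq_mul_norm_mul_sq (n := 2) (by decide) (C := 1) (ν := 1) ha one_ne_zero one_ne_zero hs
    (by rw [h]; ring) (one_mem_normUnitsSubgroup d)).2 (one_mem_normUnitsSubgroup d)

/-- The `2I`-cover `(0; 3,3,10)` (genus 15, `k = 1`, CM fourfold), `C = 1/10000 = (1/100)²`: SPLIT component `W4.d.1`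
for every census field. research route conditional on HC_CM; not a corollary; Q11.4-sentence-2 already refuted in dim ≥ 3. [cite: vanGeemen1994HodgeAV, (5.4.1)] -/
theorem fourfold_icosahedral3310_mk_C_eq_split (d : ℕ) :
    (QuotientGroup.mk (Units.mk0 ((1 : ℚ) / 10000) (by norm_num)) : weilNormResidueGroup d) =
      splitDiscriminantClass 2 d :=
  mk_eq_split_two_of_eq_sq d (s := (1 : ℚ) / 100) (by norm_num) (by norm_num) (by norm_num)

/-- The `2I`-cover `(0; 3,4,10)` = Müller–Pink's `X₁₆ : y² = s₅(x)t₅(x)` (genus 20; `J(X₁₆)` is not CM as a whole,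
its `ℍ_ℚ ⊗ ℚ(√5)`-piece is a CM fourfold, `k = 1`), `C = 1/22500 = (1/150)²`: SPLIT component `W4.d.1` for every field.
research route conditional on HC_CM; not a corollary; Q11.4-sentence-2 already refuted in dim ≥ 3. [cite: vanGeemen1994HodgeAV, (5.4.1)] -/
theorem fourfold_icosahedral3410_mk_C_eq_split (d : ℕ) :
    (QuotientGroup.mk (Units.mk0 ((1 : ℚ) / 22500) (by norm_num)) : weilNormResidueGroup d) =
      splitDiscriminantClass 2 d :=
  mk_eq_split_two_of_eq_sq d (s := (1 : ℚ) / 150) (by norm_num) (by norm_num) (by norm_num)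

/-- The `2I`-cover `(0; 3,5,5′)` (genus 17, the étale double cover of the `A₅`-curve of signature `(3,5,5)`; `k = 1`,
CM fourfold), `C = 1/225 = (1/15)²`: SPLIT for every `K` — two branch points of order `5`, `5² ≡ 1`.
research route conditional on HC_CM; not a corollary; Q11.4-sentence-2 already refuted in dim ≥ 3. [cite: vanGeemen1994HodgeAV, (5.4.1)] -/
theorem fourfold_icosahedral355_mk_C_eq_split (d : ℕ) :
    (QuotientGroup.mk (Units.mk0 ((1 : ℚ) / 225) (by norm_num)) : weilNormResidueGroup d) =
      splitDiscriminantClass 2 d :=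
  mk_eq_split_two_of_eq_sq d (s := (1 : ℚ) / 15) (by norm_num) (by norm_num) (by norm_num)

/-- The `2I`-cover `(0; 4,5,5′)` (genus 22, a double cover of Bring's curve branched in the `30`-orbit; `k = 1`, CM
fourfold), `C = 1/8100 = (1/90)²`: SPLIT for every `K`.
research route conditional on HC_CM; not a corollary; Q11.4-sentence-2 already refuted in dim ≥ 3. [cite: vanGeemen1994HodgeAV, (5.4.1)] -/
theorem fourfold_icosahedral455_mk_C_eq_split (d : ℕ) :
    (QuotientGroup.mk (Units.mk0 ((1 : ℚ) / 8100) (by norm_num)) : weilNormResidueGroup d) =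
      splitDiscriminantClass 2 d :=
  mk_eq_split_two_of_eq_sq d (s := (1 : ℚ) / 90) (by norm_num) (by norm_num) (by norm_num)

end Summit.HodgeConjecture.HodgeConjecture.Ring2.WeilCoverage

end
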